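import Literature.Algebra.EuclideanLattices.AnisotropicLatticePointCounting
import Mathlib.Data.ZMod.Basic
import HarnessLib

/-!
# Lattice points in a residue class `v + qℤⁿ` versus volume (the congruence version of
# Davenport's lemma used by Bhargava–Shankar, Thm 2.11), and `q`-periodic weighted counts

`Proofs` companion (theorems only: no definitions, no named facts) of
`AnisotropicLatticePointCounting.lean` (the anisotropic Lipschitz principle
`abs_ncard_sub_volume_le_of_forall_patch`:
`|#{z ∈ ℤⁿ : z ∈ S} − vol(S)| ≤ Σ_p N_p^m ∏_i (2 L_{p,i}/N_p + 2)` for a bounded `S ⊆ ℝⁿ` whose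
frontier is covered by coordinatewise-Lipschitz patches).

M. Bhargava, A. Shankar, *Binary quartic forms having bounded invariants, and the boundedness of
the average rank of elliptic curves*, Ann. of Math. (2) 181 (2015) 191–242, prove the congruence
version (Thm 2.11 of the held text `arXiv:1006.1002v2`, §2.5, p. 13; Thm 2.12 of the published
version) of their count of `GL₂(ℤ)`-classes of integral binary quartic forms (Thm 2.1) as follows:

> "Suppose `S` is a subset of `V_ℤ` defined by finitely many congruence conditions. We may assume
> that `S ⊂ V_ℤ` is defined by congruence conditions modulo some integer `m`. Then `S` may be
> viewed as the union of (say) `k` translates `𝓛₁, …, 𝓛_k` of the lattice `m · V_ℤ`. For each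
> such lattice translate `𝓛_j`, we may use formula (6) and the discussion following that formula
> to compute `N(𝓛_j ∩ V_ℤ^{(i)}; X)`, where each `d`-dimensional volume is scaled by a factor of
> `1/m^d` to reflect the fact that our new lattice has been scaled by a factor of `m`. … the
> number of points `(a,b,c,d,e)` in `B(n,t,λ,X) ∩ 𝓛_j` with `a ≠ 0` is … `(1/m⁵) Vol(B(n,t,λ,X))
> + O(max{C⁴t⁴λ¹⁶, 1})` … Summing over `j` … `N(S ∩ V_ℤ^{(i)}; X) = k Vol(𝓡_X(L_V^{(i)}))/(nᵢ m⁵)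
> + O(X^{3/4+ε})`."

This file supplies that step as geometry of numbers in `ℝⁿ`, for the anisotropic regions of the
tree's Davenport lemma (everything PROVED):

* §1 the residue class `{z ∈ ℤⁿ : z ≡ v (mod q)}` is the bijective image of `ℤⁿ` under
  `w ↦ v + q w`; under `x ↦ v + q x` volumes scale by `q⁻ⁿ` (`volume_real_preimage_affine`) and
  frontiers are preserved;
* §2 **`abs_ncard_congr_sub_volume_le_of_forall_patch`** — for `S` bounded with frontier covered
  by patches `φ_p` with coordinatewise Lipschitz constants `L_{p,i}`, every modulus `q ≥ 1` and
  every `v ∈ ℤⁿ`: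
  `|#{z ∈ ℤⁿ : z ≡ v (mod q), z ∈ S} − vol(S)/qⁿ| ≤ Σ_p N_p^m ∏_i (2 L_{p,i}/(q N_p) + 2)`
  ("each `d`-dimensional volume is scaled by a factor of `1/m^d`"); the same indexed by a residue
  `r ∈ (ℤ/qℤ)ⁿ` (`abs_ncard_residue_sub_volume_le_of_forall_patch`);
* §3 box bounds in a residue class: `#{z ≡ v (mod q), z ∈ S} ≤ ∏_i ((up_i − lo_i)/q + 1)` for
  `S` inside the box `∏ [lo_i, up_i]`, and `≤ ∏_{i ≠ i₀} ((up_i − lo_i)/q + 1)` for the points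
  with `z_{i₀} = 0` (Bhargava–Shankar's forms with `a = 0`, counted separately in Prop. 2.6);
* §4 **weighted counts** for a weight `Ψ : (ℤ/qℤ)ⁿ → ℝ` (a function on `V_ℤ` defined by
  congruence conditions modulo `q`, such as the local weights of the sieve of §2.7 of the
  published version): `Σ_{z ∈ S ∩ ℤⁿ} Ψ(z mod q) = Σ_r Ψ(r) · #{z ≡ r, z ∈ S}`
  (`sum_weight_eq_sum_residue_mul_card`) and hence
  `|Σ_{z ∈ S ∩ ℤⁿ} Ψ(z mod q) − (q⁻ⁿ Σ_r Ψ(r)) · vol(S)| ≤ (Σ_r |Ψ(r)|) · Σ_p N_p^m ∏_i (2 L_{p,i}/(q N_p) + 2)`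
  (`abs_sum_weight_sub_density_mul_volume_le`) — the "`k m⁻⁵ Vol`" main term with the density
  `k/m⁵ = q⁻ⁿ Σ_r 1_S(r)` of the congruence set.

## References

* M. Bhargava, A. Shankar, Ann. of Math. (2) 181 (2015) 191–242 = arXiv:1006.1002, §2.5
  "Congruence conditions", Thm 2.11 and the display before it (arXiv v2 numbering; Thm 2.12 of
  the published version). [cite: BhargavaShankarAnnals2015, §2.5 Thm 2.11 (arXiv:1006.1002v2 numbering; = Thm 2.12 published)]
* H. Davenport, *On a principle of Lipschitz*, J. London Math. Soc. 26 (1951) 179–183.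
  [cite: Davenport1951, Theorem (principle of Lipschitz)]
-/

noncomputable section

open Set MeasureTheory Metric Finset

namespace Literature.Algebra.EuclideanLattices

variable {n : ℕ}

/-! ## §1 The residue class `v + qℤⁿ` and the affine map `x ↦ v + q x` -/

/-- `z ≡ v (mod q)` coordinatewise iff `z = v + q w` for some `w ∈ ℤⁿ`. [folklore] -/
theorem forall_dvd_sub_iff_exists_eq_add_smul (q : ℕ) (v z : Fin n → ℤ) :
    (∀ i, (q : ℤ) ∣ z i - v i) ↔ ∃ w : Fin n → ℤ, z = v + (q : ℤ) • w := by
  constructor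
  · intro h
    choose w hw using h
    refine ⟨w, funext fun i => ?_⟩
    have := hw i
    simp only [Pi.add_apply, Pi.smul_apply, smul_eq_mul]
    linarith
  · rintro ⟨w, rfl⟩ i
    exact ⟨w i, by simp⟩

/-- `w ↦ v + q w` is injective on `ℤⁿ` for `q ≠ 0`. [folklore] -/
theorem add_smul_injective {q : ℕ} (hq : 0 < q) (v : Fin n → ℤ) :
    Function.Injective fun w : Fin n → ℤ => v + (q : ℤ) • w := by
  intro w w' h
  funext i
  have := congrFun h i
  simp only [Pi.add_apply, Pi.smul_apply, smul_eq_mul, add_right_inj] at this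
  exact mul_left_cancel₀ (by exact_mod_cast hq.ne') this

/-- `intPt (v + q w) = intPt v + q • intPt w`. [folklore] -/
theorem intPt_add_smul (q : ℕ) (v w : Fin n → ℤ) :
    intPt (v + (q : ℤ) • w) = intPt v + (q : ℝ) • intPt w := by
  funext i
  simp [intPt]

/-- **The residue class as an image of `ℤⁿ`.** The integer points `z ≡ v (mod q)` of `S` are in
bijection (`z = v + q w`) with the integer points `w` of the preimage of `S` under
`x ↦ v + q x`. [folklore] -/
theorem ncard_congr_eq_ncard_preimage {q : ℕ} (hq : 0 < q) (v : Fin n → ℤ) (S : Set (Fin n → ℝ)) :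
    {z : Fin n → ℤ | (∀ i, (q : ℤ) ∣ z i - v i) ∧ intPt z ∈ S}.ncard =
      {w : Fin n → ℤ | intPt w ∈ (fun x : Fin n → ℝ => intPt v + (q : ℝ) • x) ⁻¹' S}.ncard := by
  have himage : (fun w : Fin n → ℤ => v + (q : ℤ) • w) ''
      {w : Fin n → ℤ | intPt w ∈ (fun x : Fin n → ℝ => intPt v + (q : ℝ) • x) ⁻¹' S} =
        {z : Fin n → ℤ | (∀ i, (q : ℤ) ∣ z i - v i) ∧ intPt z ∈ S} := by
    ext z
    simp only [Set.mem_image, Set.mem_setOf_eq, Set.mem_preimage]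
    constructor
    · rintro ⟨w, hw, rfl⟩
      refine ⟨(forall_dvd_sub_iff_exists_eq_add_smul q v _).2 ⟨w, rfl⟩, ?_⟩
      rwa [intPt_add_smul]
    · rintro ⟨hz, hzS⟩
      obtain ⟨w, rfl⟩ := (forall_dvd_sub_iff_exists_eq_add_smul q v z).1 hz
      refine ⟨w, ?_, rfl⟩
      rwa [intPt_add_smul] at hzS
  rw [← himage, Set.ncard_image_of_injective _ (add_smul_injective hq v)]

/-- Under `x ↦ v + q x` volumes in `ℝⁿ` scale by `q⁻ⁿ`: `vol(A⁻¹ S) = vol(S)/qⁿ` ("each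
`d`-dimensional volume is scaled by a factor of `1/m^d`").
[cite: BhargavaShankarAnnals2015, §2.5 (arXiv:1006.1002v2 numbering)] -/
theorem volume_real_preimage_affine {q : ℕ} (hq : 0 < q) (v : Fin n → ℤ) (S : Set (Fin n → ℝ)) :
    volume.real ((fun x : Fin n → ℝ => intPt v + (q : ℝ) • x) ⁻¹' S) =
      volume.real S / (q : ℝ) ^ n := by
  have hq' : (q : ℝ) ≠ 0 := by exact_mod_cast hq.ne'
  have h1 : (fun x : Fin n → ℝ => intPt v + (q : ℝ) • x) ⁻¹' S =
      (fun x : Fin n → ℝ => (q : ℝ) • x) ⁻¹' ((fun y : Fin n → ℝ => intPt v + y) ⁻¹' S) := rfl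
  rw [h1, measureReal_def, Measure.addHaar_preimage_smul volume hq', measure_preimage_add,
    Module.finrank_fin_fun, ENNReal.toReal_mul, ENNReal.toReal_ofReal (abs_nonneg _),
    ← measureReal_def, abs_of_nonneg (by positivity), div_eq_inv_mul]

/-- The frontier of the preimage under the homeomorphism `x ↦ v + q x` is the preimage of the
frontier. [folklore] -/
theorem frontier_preimage_affine {q : ℕ} (hq : 0 < q) (v : Fin n → ℤ) (S : Set (Fin n → ℝ)) :
    frontier ((fun x : Fin n → ℝ => intPt v + (q : ℝ) • x) ⁻¹' S) =
      (fun x : Fin n → ℝ => intPt v + (q : ℝ) • x) ⁻¹' frontier S := by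
  have hq' : (q : ℝ) ≠ 0 := by exact_mod_cast hq.ne'
  let h : (Fin n → ℝ) ≃ₜ (Fin n → ℝ) :=
    (Homeomorph.smulOfNeZero (q : ℝ) hq').trans (Homeomorph.addLeft (intPt v))
  have hh : (h : (Fin n → ℝ) → (Fin n → ℝ)) = fun x => intPt v + (q : ℝ) • x := rfl
  rw [← hh, h.preimage_frontier]

/-- The preimage of `S` under `x ↦ v + q x` is bounded if `S` is. [folklore] -/
theorem isBounded_preimage_affine {q : ℕ} (hq : 0 < q) (v : Fin n → ℤ) {S : Set (Fin n → ℝ)}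
    (hS : Bornology.IsBounded S) :
    Bornology.IsBounded ((fun x : Fin n → ℝ => intPt v + (q : ℝ) • x) ⁻¹' S) := by
  have hq' : (0 : ℝ) < q := by exact_mod_cast hq
  obtain ⟨C, hC⟩ := isBounded_iff_forall_norm_le.1 hS
  refine isBounded_iff_forall_norm_le.2 ⟨(C + ‖intPt v‖) / q, fun x hx => ?_⟩
  have h1 : ‖intPt v + (q : ℝ) • x‖ ≤ C := hC _ hx
  have h2 : ‖(q : ℝ) • x‖ ≤ ‖intPt v + (q : ℝ) • x‖ + ‖intPt v‖ := by
    have := norm_sub_le (intPt v + (q : ℝ) • x) (intPt v)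
    rwa [add_sub_cancel_left] at this
  rw [norm_smul, Real.norm_of_nonneg hq'.le] at h2
  rw [le_div_iff₀ hq']
  linarith

/-! ## §2 Lattice points in a residue class versus volume -/

/-- **Davenport's lemma in a residue class (anisotropic form).** Let `S ⊆ ℝⁿ` be bounded with
frontier covered by finitely many patches `φ_p([0,1]^m)`, `φ_p` coordinatewise Lipschitz
(`|φ_p(x)_i − φ_p(y)_i| ≤ L_{p,i} d(x,y)`). Then for every modulus `q ≥ 1`, every `v ∈ ℤⁿ` and
any integers `N_p ≥ 1`,
`|#{z ∈ ℤⁿ : z ≡ v (mod q), z ∈ S} − vol(S)/qⁿ| ≤ Σ_p N_p^m ∏_i (2 L_{p,i}/(q N_p) + 2)`: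
the count in the translate `v + qℤⁿ` is the count of `ℤⁿ` in the region shrunk by `q`, whose
volume is `vol(S)/qⁿ` and whose patches have constants `L_{p,i}/q` (Bhargava–Shankar: "each
`d`-dimensional volume is scaled by a factor of `1/m^d` to reflect the fact that our new lattice
has been scaled by a factor of `m`").
[cite: BhargavaShankarAnnals2015, §2.5, display before Thm 2.11 (arXiv:1006.1002v2 numbering)] -/
theorem abs_ncard_congr_sub_volume_le_of_forall_patch {S : Set (Fin n → ℝ)}
    (hS : Bornology.IsBounded S)
    {P : Type*} [Fintype P] {m : ℕ} (φ : P → (Fin m → ℝ) → (Fin n → ℝ)) (L : P → Fin n → ℝ)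
    (hL : ∀ p i, 0 ≤ L p i)
    (hφ : ∀ p, ∀ x ∈ Icc (0 : Fin m → ℝ) 1, ∀ y ∈ Icc (0 : Fin m → ℝ) 1, ∀ i,
      |φ p x i - φ p y i| ≤ L p i * dist x y)
    (N : P → ℕ) (hN : ∀ p, 0 < N p)
    (hcover : frontier S ⊆ ⋃ p, φ p '' Icc (0 : Fin m → ℝ) 1)
    {q : ℕ} (hq : 0 < q) (v : Fin n → ℤ) :
    |({z : Fin n → ℤ | (∀ i, (q : ℤ) ∣ z i - v i) ∧ intPt z ∈ S}.ncard : ℝ) -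
        volume.real S / (q : ℝ) ^ n| ≤
      ∑ p, (N p : ℝ) ^ m * ∏ i, (2 * L p i / (q * N p) + 2) := by
  have hq' : (0 : ℝ) < q := by exact_mod_cast hq
  -- the affine map `A x = v + q x` and its inverse `B y = q⁻¹ (y − v)`
  set A : (Fin n → ℝ) → (Fin n → ℝ) := fun x => intPt v + (q : ℝ) • x with hA
  let B : (Fin n → ℝ) → (Fin n → ℝ) := fun y => (q : ℝ)⁻¹ • (y - intPt v)
  have hAB : ∀ y, A (B y) = y := by
    intro y
    simp only [hA, B, smul_smul, mul_inv_cancel₀ hq'.ne', one_smul, add_sub_cancel]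
  have hBA : ∀ x, B (A x) = x := by
    intro x
    simp only [hA, B, add_sub_cancel_left, smul_smul, inv_mul_cancel₀ hq'.ne', one_smul]
  rw [ncard_congr_eq_ncard_preimage hq v S, ← volume_real_preimage_affine hq v S]
  have hL' : ∀ p i, 0 ≤ L p i / q := fun p i => div_nonneg (hL p i) hq'.le
  have hφ' : ∀ p, ∀ x ∈ Icc (0 : Fin m → ℝ) 1, ∀ y ∈ Icc (0 : Fin m → ℝ) 1, ∀ i,
      |(B ∘ φ p) x i - (B ∘ φ p) y i| ≤ L p i / q * dist x y := by
    intro p x hx y hy i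
    have h := hφ p x hx y hy i
    simp only [Function.comp_apply, B, Pi.smul_apply, Pi.sub_apply, smul_eq_mul, intPt_apply]
    rw [← mul_sub, abs_mul, abs_inv, abs_of_pos hq', sub_sub_sub_cancel_right]
    calc (q : ℝ)⁻¹ * |φ p x i - φ p y i| ≤ (q : ℝ)⁻¹ * (L p i * dist x y) :=
          mul_le_mul_of_nonneg_left h (inv_nonneg.2 hq'.le)
      _ = L p i / q * dist x y := by ring
  have hcover' : frontier (A ⁻¹' S) ⊆ ⋃ p, (B ∘ φ p) '' Icc (0 : Fin m → ℝ) 1 := by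
    rw [hA, frontier_preimage_affine hq v S, ← hA]
    intro x hx
    have hx' := hcover hx
    rw [Set.mem_iUnion] at hx' ⊢
    obtain ⟨p, c, hc, hpc⟩ := hx'
    exact ⟨p, c, hc, by simp only [Function.comp_apply, hpc, hBA]⟩
  have hmain := abs_ncard_sub_volume_le_of_forall_patch (isBounded_preimage_affine hq v hS)
    (fun p => B ∘ φ p) (fun p i => L p i / q) hL' hφ' N hN hcover'
  refine hmain.trans (le_of_eq ?_)
  refine Finset.sum_congr rfl fun p _ => ?_
  congr 1
  refine Finset.prod_congr rfl fun i _ => ?_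
  rw [mul_div_assoc, div_div, ← mul_div_assoc]

/-- `z ≡ r (mod q)` in `(ℤ/qℤ)ⁿ` iff `z ≡ v (mod q)` coordinatewise for the lift `v_i = val(r_i)`.
[folklore] -/
theorem intCast_eq_iff_forall_dvd {q : ℕ} [NeZero q] (r : Fin n → ZMod q) (z : Fin n → ℤ) :
    (fun i => (z i : ZMod q)) = r ↔ ∀ i, (q : ℤ) ∣ z i - ((r i).val : ℤ) := by
  constructor
  · intro h i
    have hi : (z i : ZMod q) = r i := congrFun h i
    rw [← ZMod.intCast_zmod_eq_zero_iff_dvd]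
    push_cast
    rw [hi, ZMod.natCast_zmod_val, sub_self]
  · intro h
    funext i
    have := (ZMod.intCast_zmod_eq_zero_iff_dvd _ _).2 (h i)
    push_cast at this
    rw [ZMod.natCast_zmod_val] at this
    exact sub_eq_zero.1 this

/-- **Davenport's lemma in a residue class, indexed by `(ℤ/qℤ)ⁿ`.** For `r ∈ (ℤ/qℤ)ⁿ`,
`|#{z ∈ ℤⁿ : z mod q = r, z ∈ S} − vol(S)/qⁿ| ≤ Σ_p N_p^m ∏_i (2 L_{p,i}/(q N_p) + 2)`
(hypotheses as in `abs_ncard_congr_sub_volume_le_of_forall_patch`).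
[cite: BhargavaShankarAnnals2015, §2.5, display before Thm 2.11 (arXiv:1006.1002v2 numbering)] -/
theorem abs_ncard_residue_sub_volume_le_of_forall_patch {S : Set (Fin n → ℝ)}
    (hS : Bornology.IsBounded S)
    {P : Type*} [Fintype P] {m : ℕ} (φ : P → (Fin m → ℝ) → (Fin n → ℝ)) (L : P → Fin n → ℝ)
    (hL : ∀ p i, 0 ≤ L p i)
    (hφ : ∀ p, ∀ x ∈ Icc (0 : Fin m → ℝ) 1, ∀ y ∈ Icc (0 : Fin m → ℝ) 1, ∀ i,
      |φ p x i - φ p y i| ≤ L p i * dist x y)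
    (N : P → ℕ) (hN : ∀ p, 0 < N p)
    (hcover : frontier S ⊆ ⋃ p, φ p '' Icc (0 : Fin m → ℝ) 1)
    {q : ℕ} [NeZero q] (r : Fin n → ZMod q) :
    |({z : Fin n → ℤ | (fun i => (z i : ZMod q)) = r ∧ intPt z ∈ S}.ncard : ℝ) -
        volume.real S / (q : ℝ) ^ n| ≤
      ∑ p, (N p : ℝ) ^ m * ∏ i, (2 * L p i / (q * N p) + 2) := by
  have hq : 0 < q := Nat.pos_of_ne_zero (NeZero.ne q)
  have hset : {z : Fin n → ℤ | (fun i => (z i : ZMod q)) = r ∧ intPt z ∈ S} =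
      {z : Fin n → ℤ | (∀ i, (q : ℤ) ∣ z i - (fun i => ((r i).val : ℤ)) i) ∧ intPt z ∈ S} := by
    ext z
    simp only [Set.mem_setOf_eq, intCast_eq_iff_forall_dvd]
  rw [hset]
  exact abs_ncard_congr_sub_volume_le_of_forall_patch hS φ L hL hφ N hN hcover hq _

/-! ## §3 Box bounds in a residue class -/

/-- The integer points `z ≡ v (mod q)` of a set inside the box `∏_i [lo_i, up_i]` number at most
`∏_i ((up_i − lo_i)/q + 1)`. [folklore] -/
theorem ncard_congr_le_of_subset_box {S : Set (Fin n → ℝ)} (lo up : Fin n → ℝ)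
    (hloup : ∀ i, lo i ≤ up i) (hS : ∀ x ∈ S, ∀ i, lo i ≤ x i ∧ x i ≤ up i)
    {q : ℕ} (hq : 0 < q) (v : Fin n → ℤ) :
    ({z : Fin n → ℤ | (∀ i, (q : ℤ) ∣ z i - v i) ∧ intPt z ∈ S}.ncard : ℝ) ≤
      ∏ i, ((up i - lo i) / q + 1) := by
  have hq' : (0 : ℝ) < q := by exact_mod_cast hq
  rw [ncard_congr_eq_ncard_preimage hq v S]
  have h := ncard_setOf_intPt_mem_le (S := (fun x : Fin n → ℝ => intPt v + (q : ℝ) • x) ⁻¹' S)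
    (fun i => (lo i - v i) / q) (fun i => (up i - v i) / q)
    (fun i => div_le_div_of_nonneg_right (by linarith [hloup i]) hq'.le) ?_
  · refine h.trans (le_of_eq (Finset.prod_congr rfl fun i _ => by field_simp; ring))
  · intro x hx i
    obtain ⟨h1, h2⟩ := hS _ hx i
    simp only [Pi.add_apply, intPt_apply, Pi.smul_apply, smul_eq_mul] at h1 h2
    rw [div_le_iff₀ hq', le_div_iff₀ hq']
    constructor <;> linarith

/-- The integer points `z ≡ v (mod q)` with `z_{i₀} = 0` of a set inside the box `∏_i [lo_i, up_i]`
number at most `∏_{i ≠ i₀} ((up_i − lo_i)/q + 1)` (Bhargava–Shankar, Prop. 2.6 and §2.5: the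
forms with `a = 0` in a translate of `m · V_ℤ` are set aside, being reducible). [folklore] -/
theorem ncard_congr_coord_eq_zero_le_of_subset_box {S : Set (Fin n → ℝ)} (lo up : Fin n → ℝ)
    (hloup : ∀ i, lo i ≤ up i) (hS : ∀ x ∈ S, ∀ i, lo i ≤ x i ∧ x i ≤ up i)
    {q : ℕ} (hq : 0 < q) (v : Fin n → ℤ) (i₀ : Fin n) :
    ({z : Fin n → ℤ | (∀ i, (q : ℤ) ∣ z i - v i) ∧ intPt z ∈ S ∧ z i₀ = 0}.ncard : ℝ) ≤
      ∏ i ∈ Finset.univ.erase i₀, ((up i - lo i) / q + 1) := by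
  classical
  have hq' : (0 : ℝ) < q := by exact_mod_cast hq
  have hqz : (q : ℤ) ≠ 0 := by exact_mod_cast hq.ne'
  -- `z ↦ w = (z − v)/q` injects the set into a box of `w`'s with `w_{i₀}` fixed
  let I : Fin n → Finset ℤ := fun i =>
    if i = i₀ then {(-v i₀) / (q : ℤ)} else Finset.Icc ⌈(lo i - v i) / (q : ℝ)⌉ ⌊(up i - v i) / (q : ℝ)⌋
  let box : Finset (Fin n → ℤ) := Fintype.piFinset I
  let F : (Fin n → ℤ) → (Fin n → ℤ) := fun z i => (z i - v i) / (q : ℤ)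
  have hinj : Set.InjOn F {z : Fin n → ℤ | (∀ i, (q : ℤ) ∣ z i - v i) ∧ intPt z ∈ S ∧ z i₀ = 0} := by
    intro z hz z' hz' h
    funext i
    have hi : (z i - v i) / (q : ℤ) = (z' i - v i) / (q : ℤ) := congrFun h i
    have h1 := Int.ediv_mul_cancel (hz.1 i)
    have h2 := Int.ediv_mul_cancel (hz'.1 i)
    have : z i - v i = z' i - v i := by rw [← h1, ← h2, hi]
    linarith
  have hmaps : Set.MapsTo F {z : Fin n → ℤ | (∀ i, (q : ℤ) ∣ z i - v i) ∧ intPt z ∈ S ∧ z i₀ = 0}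
      (box : Set (Fin n → ℤ)) := by
    rintro z ⟨hz, hzS, hz0⟩
    simp only [Finset.mem_coe, box, Fintype.mem_piFinset]
    intro i
    by_cases hi : i = i₀
    · subst hi
      simp [I, F, hz0]
    · simp only [I, if_neg hi, Finset.mem_Icc, F]
      obtain ⟨h1, h2⟩ := hS _ hzS i
      simp only [intPt_apply] at h1 h2
      obtain ⟨w, hw⟩ := hz i
      have hwq : (z i - v i) / (q : ℤ) = w := by
        rw [hw, Int.mul_ediv_cancel_left _ hqz]
      rw [hwq, Int.ceil_le, Int.le_floor, div_le_iff₀ hq', le_div_iff₀ hq']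
      have hw' : ((z i : ℤ) : ℝ) - v i = q * w := by exact_mod_cast hw
      constructor <;> nlinarith
  have h1 : ({z : Fin n → ℤ | (∀ i, (q : ℤ) ∣ z i - v i) ∧ intPt z ∈ S ∧ z i₀ = 0}.ncard : ℝ) ≤
      box.card := by
    have := Set.ncard_le_ncard_of_injOn F hmaps hinj box.finite_toSet
    rw [Set.ncard_coe_finset] at this
    exact_mod_cast this
  refine h1.trans ?_
  rw [Fintype.card_piFinset, ← Finset.prod_erase_mul _ _ (Finset.mem_univ i₀)]
  simp only [I, if_pos rfl, Finset.card_singleton, Nat.cast_prod, mul_one]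
  refine Finset.prod_le_prod (fun i _ => by positivity) fun i hi => ?_
  rw [Finset.mem_erase] at hi
  rw [if_neg hi.1]
  refine (card_Icc_ceil_floor_le'
    (div_le_div_of_nonneg_right (by linarith [hloup i]) hq'.le)).trans (le_of_eq ?_)
  field_simp
  ring

/-! ## §4 Weighted counts with a `q`-periodic weight -/

/-- The integer points of a bounded set form a finite set. [folklore] -/
theorem finite_setOf_intPt_mem {S : Set (Fin n → ℝ)} (hS : Bornology.IsBounded S) :
    {z : Fin n → ℤ | intPt z ∈ S}.Finite := by
  classical
  obtain ⟨C, hC⟩ := isBounded_iff_forall_norm_le.1 hS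
  let box : Finset (Fin n → ℤ) := Fintype.piFinset fun _ => Finset.Icc ⌈-C⌉ ⌊C⌋
  refine box.finite_toSet.subset fun z hz => ?_
  simp only [Finset.mem_coe, box, Fintype.mem_piFinset, Finset.mem_Icc]
  intro i
  have h := (norm_le_pi_norm (intPt z) i).trans (hC _ hz)
  rw [intPt_apply, Real.norm_eq_abs, abs_le] at h
  exact ⟨Int.ceil_le.2 h.1, Int.le_floor.2 h.2⟩

/-- **Fibrewise decomposition of a weighted count.** For a finite set `Z ⊆ ℤⁿ` and a weight
`Ψ` on `(ℤ/qℤ)ⁿ`, `Σ_{z ∈ Z} Ψ(z mod q) = Σ_{r ∈ (ℤ/qℤ)ⁿ} Ψ(r) · #{z ∈ Z : z mod q = r}`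
(Bhargava–Shankar: "`S` may be viewed as the union of `k` translates `𝓛₁, …, 𝓛_k` of the lattice
`m · V_ℤ` … Summing over `j`"). [cite: BhargavaShankarAnnals2015, §2.5 (arXiv:1006.1002v2 numbering)] -/
theorem sum_weight_eq_sum_residue_mul_card {q : ℕ} [NeZero q] (Z : Finset (Fin n → ℤ))
    (Ψ : (Fin n → ZMod q) → ℝ) :
    ∑ z ∈ Z, Ψ (fun i => (z i : ZMod q)) =
      ∑ r : Fin n → ZMod q, Ψ r * ((Z.filter fun z => (fun i => (z i : ZMod q)) = r).card : ℝ) := by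
  classical
  rw [← Finset.sum_fiberwise_of_maps_to' (s := Z) (t := Finset.univ)
    (g := fun z : Fin n → ℤ => fun i => (z i : ZMod q)) (fun _ _ => Finset.mem_univ _) Ψ]
  refine Finset.sum_congr rfl fun r _ => ?_
  rw [Finset.sum_const, nsmul_eq_mul, mul_comm]

/-- The fibre cardinality as an `ncard`: for `Z` the set of integer points of `S`,
`#{z ∈ Z : z mod q = r} = #{z ∈ ℤⁿ : z mod q = r, z ∈ S}`. [folklore] -/
theorem card_filter_residue_eq_ncard {q : ℕ} {S : Set (Fin n → ℝ)} (Z : Finset (Fin n → ℤ))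
    (hZ : ∀ z, z ∈ Z ↔ intPt z ∈ S) (r : Fin n → ZMod q) [DecidableEq (Fin n → ZMod q)] :
    ((Z.filter fun z => (fun i => (z i : ZMod q)) = r).card : ℝ) =
      ({z : Fin n → ℤ | (fun i => (z i : ZMod q)) = r ∧ intPt z ∈ S}.ncard : ℝ) := by
  congr 1
  rw [← Set.ncard_coe_finset]
  congr 1
  ext z
  simp only [Finset.coe_filter, Set.mem_setOf_eq, hZ]
  tauto

/-- **Weighted count versus density times volume.** Let `S ⊆ ℝⁿ` be bounded with frontier covered
by coordinatewise-Lipschitz patches as in `abs_ncard_congr_sub_volume_le_of_forall_patch`, let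
`Z` be the (finite) set of its integer points and `Ψ` a weight on `(ℤ/qℤ)ⁿ` (a function on `ℤⁿ`
defined by congruence conditions modulo `q`). Then
`|Σ_{z ∈ Z} Ψ(z mod q) − (q⁻ⁿ Σ_r Ψ(r)) · vol(S)| ≤ (Σ_r |Ψ(r)|) · Σ_p N_p^m ∏_i (2 L_{p,i}/(q N_p) + 2)`;
for `Ψ = 1_{S'}` the indicator of a union of `k` residue classes this is Bhargava–Shankar's
`N = (k/m⁵) Vol + O(…)`, `k/m⁵ = ∏_p μ_p(S')`.
[cite: BhargavaShankarAnnals2015, §2.5, Thm 2.11 and the display before it (arXiv:1006.1002v2 numbering)] -/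
theorem abs_sum_weight_sub_density_mul_volume_le {S : Set (Fin n → ℝ)}
    (hS : Bornology.IsBounded S)
    {P : Type*} [Fintype P] {m : ℕ} (φ : P → (Fin m → ℝ) → (Fin n → ℝ)) (L : P → Fin n → ℝ)
    (hL : ∀ p i, 0 ≤ L p i)
    (hφ : ∀ p, ∀ x ∈ Icc (0 : Fin m → ℝ) 1, ∀ y ∈ Icc (0 : Fin m → ℝ) 1, ∀ i,
      |φ p x i - φ p y i| ≤ L p i * dist x y)
    (N : P → ℕ) (hN : ∀ p, 0 < N p)
    (hcover : frontier S ⊆ ⋃ p, φ p '' Icc (0 : Fin m → ℝ) 1)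
    {q : ℕ} [NeZero q] (Ψ : (Fin n → ZMod q) → ℝ)
    (Z : Finset (Fin n → ℤ)) (hZ : ∀ z, z ∈ Z ↔ intPt z ∈ S) :
    |∑ z ∈ Z, Ψ (fun i => (z i : ZMod q)) -
        (∑ r : Fin n → ZMod q, Ψ r) / (q : ℝ) ^ n * volume.real S| ≤
      (∑ r : Fin n → ZMod q, |Ψ r|) * ∑ p, (N p : ℝ) ^ m * ∏ i, (2 * L p i / (q * N p) + 2) := by
  classical
  set E : ℝ := ∑ p, (N p : ℝ) ^ m * ∏ i, (2 * L p i / (q * N p) + 2) with hE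
  have hfib : ∀ r : Fin n → ZMod q,
      |((Z.filter fun z => (fun i => (z i : ZMod q)) = r).card : ℝ) - volume.real S / (q : ℝ) ^ n|
        ≤ E := by
    intro r
    rw [card_filter_residue_eq_ncard Z hZ r]
    exact abs_ncard_residue_sub_volume_le_of_forall_patch hS φ L hL hφ N hN hcover r
  rw [sum_weight_eq_sum_residue_mul_card Z Ψ, Finset.sum_div, Finset.sum_mul, ← Finset.sum_sub_distrib,
    Finset.sum_mul]
  refine (Finset.abs_sum_le_sum_abs _ _).trans (Finset.sum_le_sum fun r _ => ?_)
  rw [div_mul_eq_mul_div, mul_div_assoc, ← mul_sub, abs_mul]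
  exact mul_le_mul_of_nonneg_left (hfib r) (abs_nonneg _)

/-- **Weighted count, `sup`-norm form**: under the same hypotheses,
`|Σ_{z ∈ Z} Ψ(z mod q) − (q⁻ⁿ Σ_r Ψ(r)) · vol(S)| ≤ qⁿ · M · Σ_p N_p^m ∏_i (2 L_{p,i}/(q N_p) + 2)`
whenever `|Ψ| ≤ M` (the error of the congruence count grows at most like `qⁿ` times the error of
the shrunk region, i.e. like `q · (error for q = 1)` when `N_p ≍ L_min/q`).
[cite: BhargavaShankarAnnals2015, §2.5, Thm 2.11 (arXiv:1006.1002v2 numbering)] -/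
theorem abs_sum_weight_sub_density_mul_volume_le_of_bound {S : Set (Fin n → ℝ)}
    (hS : Bornology.IsBounded S)
    {P : Type*} [Fintype P] {m : ℕ} (φ : P → (Fin m → ℝ) → (Fin n → ℝ)) (L : P → Fin n → ℝ)
    (hL : ∀ p i, 0 ≤ L p i)
    (hφ : ∀ p, ∀ x ∈ Icc (0 : Fin m → ℝ) 1, ∀ y ∈ Icc (0 : Fin m → ℝ) 1, ∀ i,
      |φ p x i - φ p y i| ≤ L p i * dist x y)
    (N : P → ℕ) (hN : ∀ p, 0 < N p)
    (hcover : frontier S ⊆ ⋃ p, φ p '' Icc (0 : Fin m → ℝ) 1)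
    {q : ℕ} [NeZero q] (Ψ : (Fin n → ZMod q) → ℝ) {M : ℝ} (hM : ∀ r, |Ψ r| ≤ M)
    (Z : Finset (Fin n → ℤ)) (hZ : ∀ z, z ∈ Z ↔ intPt z ∈ S) :
    |∑ z ∈ Z, Ψ (fun i => (z i : ZMod q)) -
        (∑ r : Fin n → ZMod q, Ψ r) / (q : ℝ) ^ n * volume.real S| ≤
      (q : ℝ) ^ n * M * ∑ p, (N p : ℝ) ^ m * ∏ i, (2 * L p i / (q * N p) + 2) := by
  refine (abs_sum_weight_sub_density_mul_volume_le hS φ L hL hφ N hN hcover Ψ Z hZ).trans ?_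
  have hE : 0 ≤ ∑ p, (N p : ℝ) ^ m * ∏ i, (2 * L p i / (q * N p) + 2) :=
    Finset.sum_nonneg fun p _ => mul_nonneg (by positivity)
      (Finset.prod_nonneg fun i _ => by have := hL p i; positivity)
  refine mul_le_mul_of_nonneg_right ?_ hE
  calc ∑ r : Fin n → ZMod q, |Ψ r| ≤ ∑ _r : Fin n → ZMod q, M := Finset.sum_le_sum fun r _ => hM r
    _ = (q : ℝ) ^ n * M := by
        rw [Finset.sum_const, Finset.card_univ, Fintype.card_fun, ZMod.card, Fintype.card_fin,
          nsmul_eq_mul]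
        push_cast
        ring

end Literature.Algebra.EuclideanLattices

end
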